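import Summits.BirchSwinnertonDyer.BirchSwinnertonDyer.Theorems.AdditiveBranchIMCMultLowerPartnerLowerSkinnerCore
import Literature.NumberTheory.EllipticCurves.Delbourgo1998.RankZeroLeadingTerm
import Literature.NumberTheory.EllipticCurves.Wuthrich2014.SurjectiveDivisibilityCyclotomicPrimeHalf
import Literature.NumberTheory.EllipticCurves.NonvanishingTwistsPrescribedRamificationSplit
import Literature.NumberTheory.EllipticCurves.NonvanishingTwistsPrescribedRamificationSimpleZero
import Literature.NumberTheory.EllipticCurves.BSDQuadraticDescent
import Literature.NumberTheory.EllipticCurves.BSDRootNumber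
import Literature.NumberTheory.EllipticCurves.GrossZagierRationalPoint
import Literature.NumberTheory.EllipticCurves.Hsieh2014.AnticyclotomicPAdicLFunctionRamifiedSteinberg
import Literature.NumberTheory.EllipticCurves.LiuZhangZhang2018.PAdicWaldspurgerEllipticCurveAdditiveRamifiedSteinberg
import Literature.NumberTheory.EllipticCurves.CaiShuTian2014.ExplicitGrossZagier
import Literature.NumberTheory.EllipticCurves.CaiShuTian2014.ExplicitGrossZagierRingClass
import Literature.NumberTheory.EllipticCurves.Voight2007.RingClassGenusField
import Literature.NumberTheory.EllipticCurves.ManinConstantSemistablePrimewise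
import Literature.NumberTheory.EllipticCurves.Gross2004.RationalCharacterLSeries
import HarnessLib

/-!
# Registered stub `stub_partnerLowerSkinner` of line `tame_roads_mult` v3 — PROVED, BY NAME AND SIGNATURE
# (crux `AdditiveBranchIMC.MultLower`, stmt-BirchSwinnertonDyer-19359, route K1 `AdditiveBranchIMC`;
# stub-worker `bsd-line-addord-w3` under LEAD `cruxlead-stmt-BirchSwinnertonDyer-19357`;
# `--supports stmt-BirchSwinnertonDyer-19359`)

HONEST FRAMING. One theorem and one cite-only conjunction (a `def … : Prop`, nothing asserted); no
named fact; no `sorry`; BSD is proved for no curve by this file, and the crux item stays OPEN (six other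
registered stubs of the line are untouched). The registered stub (skeleton v3, commit 06f14dad4cfd) —
VERBATIM: the LOWER half `MissingLowerBoundAt A p` (`ord_p #Ш_an(A) ≤ ord_p #Ш(A)`, `#Ш_an` rational)
of the MULTIPLICATIVE rank-zero partner `A` of the (M) three-field road, at `p ≥ 5` with `A`
multiplicative at `p`, `ρ̄_{A,p}` onto and a multiplicative prime `ℓ ≠ p` at which `ρ̄_{A,p}` is
ramified (`p ∤ v_ℓ(Δ_min)`), from the line's cite-only conjunction `PrintedFactsM`.

PROOF. The core file `AdditiveBranchIMCMultLowerPartnerLowerSkinnerCore.lean`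
(`missingLowerBoundAt_rankZero_mult_of_thmC`: Skinner 2016 Thm. C
`Skinner2016.thmC_padicValRat_bsd_rank_zero` — multiplicative `p` allowed, `A[p]` irreducible from
`Surj` —, modularity `hasEntireLFunction_rat`, Gross–Zagier–Kolyvagin
`rank_eq_analyticRank_of_analyticRank_le_one` ⟹ `BSDp A p` by `bsdp_of_pPartRankZero` ⟹
`MissingPPartAt` ⟹ `MissingLowerBoundAt` by the typed bookkeeping) applied to the conjuncts 11, 3, 2
of `PrintedFactsM`; `5 ≤ p` is only used as `3 ≤ p`.

WHY A `def` HERE. The stub is registered with the header `PrintedFactsM → ∀ (A …) …, … →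
MissingLowerBoundAt A p`, where `PrintedFactsM` is the LINE's cite-only conjunction declared in the
skeleton `Cruxes/MultLower/Lines/tame_roads_mult.lean` — a module outside the Theorems import fence. To
state the stub BY NAME AND SIGNATURE the conjunction is REPEATED VERBATIM below (same eighteen conjuncts,
same order, same spelling); the two constants are definitionally equal, so the LEAD's composition can
discharge this file's hypothesis with its own `stub_printedFactsM` (or call the core theorem on the
components). Nothing is asserted by the `def`; it is line vocabulary, not a Literature fact and not an
obligation.

References (locators only): [cite: Skinner2016PacificMC, Thm. C (§1), footnote 1, §2.5]
[cite: Miller2011LMS, Def. 1.1 (arXiv:1010.2431 p. 3)]. presearch: n/a (assembly of tree theorems;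
no new mathematics). Axioms: `propext`, `Classical.choice`, `Quot.sound`.
-/

set_option autoImplicit false
-- D-0017: single-problem summit, so `Summit.BirchSwinnertonDyer.BirchSwinnertonDyer.…` repeats a namespace BY DESIGN.
set_option linter.dupNamespace false

noncomputable section

open scoped Classical

namespace Summit.BirchSwinnertonDyer.BirchSwinnertonDyer.Theorems.AdditiveBranchIMCTameRoadsMult

open NumberField IsDedekindDomain
open WeierstrassCurve Literature.NumberTheory.EllipticCurves
  Literature.NumberTheory.EllipticCurves.ModularForms
  Literature.NumberTheory.EllipticCurves.Rank1Residual
  Literature.NumberTheory.EllipticCurves.Rank1Residual.Typed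
open Field

/-- The printed theorems the (M) tame roads consume BY NAME — cite-only conjunction, VERBATIM the
skeleton's `PrintedFactsM` (line `tame_roads_mult` v3, `Cruxes/MultLower/Lines/`): Delbourgo 1998 Prop 4,
GZK, entire continuation, a modular parametrisation, Kato–Wuthrich half (the five inputs of the twist's
rank-0 upper half, first, in this order); F5, F6 (Friedberg–Hoffstein with Castella–Wan local data, value
resp. simple zero); parity; Cassels; Gross–Zagier I.(7.3); Skinner 2016 Thm C
(`Skinner2016.thmC_padicValRat_bsd_rank_zero`); Cai–Shu–Tian Thm 1.1 (trivial and ring class character);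
Voight 2007 Prop. 3.8; Mazur 1978 Cor. 4.1; Hsieh 2014 Thm B; Liu–Zhang–Zhang Thm 1.5.1+1.5.3; Gross 2004
§2 (last). Line vocabulary repeated so that the registered stub can be stated by name and signature under
the Theorems import fence; NOTHING IS ASSERTED (each conjunct is an existing tree `Prop`, cited where it is
declared). -/
def PrintedFactsM : Prop :=
  Delbourgo1998.prop4_rankZero_pow_dvd_constantCoeff ∧
    Literature.NumberTheory.EllipticCurves.rank_eq_analyticRank_of_analyticRank_le_one ∧
    WeierstrassCurve.hasEntireLFunction_rat ∧
    Literature.NumberTheory.EllipticCurves.ModularForms.nonempty_modularParametrizationData ∧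
    Wuthrich2014.kato_halfEigenCharIdeal_dvd_cyclotomicPrime_of_surjective ∧
    friedbergHoffstein_exists_twist_ne_zero_ramifiedAt_splitAt ∧
    friedbergHoffstein_exists_twist_simpleZero_ramifiedAt_splitAt ∧
    (∀ W : WeierstrassCurve ℚ,
      Literature.NumberTheory.EllipticCurves.even_analyticRank_iff_rootNumber_eq_one W) ∧
    WeierstrassCurve.bsdRHS_eq_of_isIsogenous ∧
    Literature.NumberTheory.EllipticCurves.GrossZagier1986_thm_I_7_3 ∧
    Skinner2016.thmC_padicValRat_bsd_rank_zero ∧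
    CaiShuTian2014.thm11_trivialChar ∧
    CaiShuTian2014.thm11_ringClassChar ∧
    Voight2007.prop38_sqrt_mem_ringClassField_iff ∧
    mazur_not_dvd_maninConstant_of_odd ∧
    Hsieh2014.thmB_exists_isHsiehLFunction_coeff_norm_eq_one_unrPeriod_ramifiedSteinberg ∧
    LiuZhangZhang2018.thm151_thm153_modularCurve_heegnerVector_additive_ramifiedSteinberg ∧
    Gross2004.rankinLSeries_eq_mul_quadraticTwist

/-- Unfolding of `PrintedFactsM` (by definition): the three conjuncts the partner's lower half uses —
GZK (2nd), modularity (3rd), Skinner 2016 Thm C (11th) — are projections of it. [folklore] -/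
theorem PrintedFactsM.thmC (h : PrintedFactsM) :
    Literature.NumberTheory.EllipticCurves.rank_eq_analyticRank_of_analyticRank_le_one ∧
      WeierstrassCurve.hasEntireLFunction_rat ∧ Skinner2016.thmC_padicValRat_bsd_rank_zero :=
  ⟨h.2.1, h.2.2.1, h.2.2.2.2.2.2.2.2.2.2.1⟩

/-- **Registered stub `stub_partnerLowerSkinner` of line `tame_roads_mult` v3** (crux `MultLower`,
stmt-BirchSwinnertonDyer-19359), BY NAME AND SIGNATURE — the LOWER half of the multiplicative rank-zero
partner is Skinner 2016 Thm C BY NAME (`Skinner2016.thmC_padicValRat_bsd_rank_zero` of `PrintedFactsM`: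
`p ≥ 3`, multiplicative at `p`, `E[p]` irreducible (from `Surj`), (ram) at `ℓ ≠ p`, `L(A,1) ≠ 0` (from
`r_an = 0` and `hasEntireLFunction_rat`), `Ш(A)` finite (GZK)) + the rank-0 `Ш_an` bookkeeping
`shaAn A = L(A,1)·#tors² / (Ω_A ∏ c_ℓ)` ⟹ `ord_p #Ш_an(A) = ord_p #Ш(A)`, in particular `≤`; here: the
core theorem `missingLowerBoundAt_rankZero_mult_of_thmC` on the conjuncts 11, 3, 2 of `PrintedFactsM`.
[cite: Skinner2016PacificMC, Thm. C (§1)] [cite: Miller2011LMS, Def. 1.1] -/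
theorem stub_partnerLowerSkinner : PrintedFactsM →
    ∀ (A : WeierstrassCurve ℚ) [A.IsElliptic] [A.IsGloballyMinimal] (p : ℕ) [Fact p.Prime],
      5 ≤ p → A.analyticRank = 0 → A.HasMultiplicativeReductionAtPrime p → Surj A p →
        (∃ ℓ : ℕ, ∃ _ : Fact ℓ.Prime, ℓ ≠ p ∧ A.HasMultiplicativeReductionAtPrime ℓ ∧
            ¬ p ∣ padicValInt ℓ A.minimalDiscriminantInt) →
        MissingLowerBoundAt A p := by
  intro hPF A _ _ p _ h5 hr hmult hsurj hram
  obtain ⟨hGZK, hmod, hSk⟩ := hPF.thmC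
  exact missingLowerBoundAt_rankZero_mult_of_thmC hSk hmod hGZK A p h5 hr hmult hsurj hram

end Summit.BirchSwinnertonDyer.BirchSwinnertonDyer.Theorems.AdditiveBranchIMCTameRoadsMult

end
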